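import Mathlib
import Literature.NumberTheory.Transcendental.KZProduct
import Literature.NumberTheory.Transcendental.KZProductIdeal
import Literature.NumberTheory.Transcendental.KZVolumeConjectureProofs
import Summits.KontsevichZagierPeriods.KontsevichZagierPeriods.Theorems.SoloInformedVolumeLadder
import Summits.KontsevichZagierPeriods.KontsevichZagierPeriods.Theorems.SoloInformedTorsionFree
import Summits.KontsevichZagierPeriods.KontsevichZagierPeriods.Theorems.SoloInformedCone
import Summits.KontsevichZagierPeriods.KontsevichZagierPeriods.Theorems.SoloInformedDilation
import HarnessLib
import HarnessLib.Audit

/-!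
# SoloInformed — cones of integer height in the Kontsevich–Zagier calculus

`SoloInformedCone` proved `3·[C K, 1] − [K, 1] ∈ relations` for the cone `C K = {(t y, t) : y ∈ K, 0 ≤ t ≤ 1}`
of height `1` over a compact planar representation `K` with integrand `1`. Composing with the vertical
dilation `Φ_c(x, y, z) = (x, y, c z)` of `SoloInformedDilation` (`[Φ_c σ, 1] − c·[σ, 1] ∈ relations`) gives
the cone `C_c K = Φ_c(C K)` of any integer height `c ≥ 1`:

* `soloInformed_three_nsmul_coneHeightRep_sub_mem_relations`: `3·[C_c K, 1] − c·[K, 1] ∈ relations`;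
* `soloInformed_value_coneHeightRep`: `3 · vol(C_c K) = c · area(K)`;
* `soloInformed_coneHeight_equivalent_of_value_eq` (granted Huber–Wüstholz, through volume rung `2`):
  two cones of the same integer height over compact planar regions with non-empty interior and equal
  volume are KZ-equivalent.

This removes the restriction "height `1`" from the cone instance of the fibration mechanism (residency
paper, §6sexies Remark): the open content of volume rung `3` lies in comparisons ACROSS algebraic
fibration classes. Residency `solo-KontsevichZagierPeriods-informed` (PLAN.md, session s16).
References: M. Kontsevich, D. Zagier, *Periods* (2001), §1.2.
-/

noncomputable section

namespace Summit.KontsevichZagierPeriods.KontsevichZagierPeriods.Theorems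

open Literature.NumberTheory.Transcendental Literature.NumberTheory.Transcendental.KZ

/-- **The cone of integer height `c` over `K`**: the vertical dilate `Φ_c (C K)` of the height-one cone,
with integrand `1`; its domain is `{(x, y, z) : (x, y, z / c) ∈ C K}` for `c ≠ 0`
(`soloInformedZScale_image`). -/
def soloInformedConeHeightRep (K : IntegralRep 2) (hKc : IsCompact K.domain) (c : ℕ) : IntegralRep 3 :=
  soloInformedStretchRep (soloInformedConeRep K hKc) (isCompact_soloInformedCone K hKc) c

/-- The domain of the height-`c` cone is the `Φ_c`-image of the height-one cone. -/
theorem soloInformedConeHeightRep_domain (K : IntegralRep 2) (hKc : IsCompact K.domain) (c : ℕ) :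
    (soloInformedConeHeightRep K hKc c).domain = soloInformedZScale c '' soloInformedCone K :=
  rfl

/-- The height-`c` cone has compact domain. -/
theorem isCompact_soloInformedConeHeightRep_domain (K : IntegralRep 2) (hKc : IsCompact K.domain)
    (c : ℕ) : IsCompact (soloInformedConeHeightRep K hKc c).domain :=
  isCompact_soloInformedStretchRep_domain _ _ c

/-- The height-`c` cone has integrand `1`. -/
theorem soloInformedConeHeightRep_integrand (K : IntegralRep 2) (hKc : IsCompact K.domain) (c : ℕ)
    (x : Fin 3 → ℝ) : (soloInformedConeHeightRep K hKc c).integrand x = 1 :=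
  rfl

/-- **Cones of integer height in the calculus**: `3·[C_c K, 1] − c·[K, 1] ∈ relations` for a compact
planar representation `K` with integrand `1` and `c ≥ 1`. [Kontsevich–Zagier 2001, §1.2 (rules)] -/
theorem soloInformed_three_nsmul_coneHeightRep_sub_mem_relations (K : IntegralRep 2)
    (hKc : IsCompact K.domain) (hK1 : ∀ y ∈ K.domain, K.integrand y = 1) (c : ℕ) (hc : c ≠ 0) :
    3 • of (soloInformedConeHeightRep K hKc c) - c • of K ∈ relations := by
  have hS := soloInformed_stretchRep_sub_nsmul_mem_relations (soloInformedConeRep K hKc)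
    (isCompact_soloInformedCone K hKc) (fun _ _ => rfl) c hc
  have hC := soloInformed_three_nsmul_coneRep_sub_mem_relations K hKc hK1
  have e : 3 • of (soloInformedConeHeightRep K hKc c) - c • of K =
      3 • (of (soloInformedStretchRep (soloInformedConeRep K hKc) (isCompact_soloInformedCone K hKc) c)
        - c • of (soloInformedConeRep K hKc)) +
      c • (3 • of (soloInformedConeRep K hKc) - of K) := by
    rw [soloInformedConeHeightRep, nsmul_sub, nsmul_sub, smul_comm (3 : ℕ) c]; abel
  rw [e]
  exact relations.add_mem (relations.nsmul_mem hS 3) (relations.nsmul_mem hC c)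

/-- The volume of the height-`c` cone: `3 · vol(C_c K) = c · area(K)`. -/
theorem soloInformed_value_coneHeightRep (K : IntegralRep 2) (hKc : IsCompact K.domain)
    (hK1 : ∀ y ∈ K.domain, K.integrand y = 1) (c : ℕ) (hc : c ≠ 0) :
    3 * (soloInformedConeHeightRep K hKc c).value = c * K.value := by
  have h := eval_eq_zero_of_mem_relations
    (soloInformed_three_nsmul_coneHeightRep_sub_mem_relations K hKc hK1 c hc)
  simp only [map_sub, map_nsmul, eval_of, nsmul_eq_mul, Nat.cast_ofNat] at h
  linarith

/-- The height-`c` cone over a region with non-empty interior has non-empty interior (`c ≠ 0`). -/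
theorem soloInformed_interior_coneHeightRep_nonempty (K : IntegralRep 2) (hKc : IsCompact K.domain)
    (c : ℕ) (hc : c ≠ 0) (hi : (interior (soloInformedConeRep K hKc).domain).Nonempty) :
    (interior (soloInformedConeHeightRep K hKc c).domain).Nonempty :=
  soloInformed_interior_stretchRep_nonempty _ _ c hc hi

/-- **Volume rung `3` for cones of a common integer height** (granted the Huber–Wüstholz theorem on
curve periods, through volume rung `2`): if `C_c K` and `C_c K'` (`c ≥ 1`) have the same volume then
they are KZ-equivalent. Proof: `3·[C_c K] ∼ c·[K]`, `3·[C_c K'] ∼ c·[K']`, equal volumes give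
`area(K) = area(K')`, hence `[K] ∼ [K']` by rung `2`, and `3·x ∈ relations ⇒ x ∈ relations`. -/
theorem soloInformed_coneHeight_equivalent_of_value_eq (hHW : HuberWustholzCurvePeriods)
    (K K' : IntegralRep 2) (hKc : IsCompact K.domain) (hKi : (interior K.domain).Nonempty)
    (hK1 : ∀ y ∈ K.domain, K.integrand y = 1) (hKc' : IsCompact K'.domain)
    (hKi' : (interior K'.domain).Nonempty) (hK1' : ∀ y ∈ K'.domain, K'.integrand y = 1)
    (c : ℕ) (hc : c ≠ 0)
    (h : (soloInformedConeHeightRep K hKc c).value = (soloInformedConeHeightRep K' hKc' c).value) :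
    Equivalent (soloInformedConeHeightRep K hKc c) (soloInformedConeHeightRep K' hKc' c) := by
  have h3 := soloInformed_three_nsmul_coneHeightRep_sub_mem_relations K hKc hK1 c hc
  have h3' := soloInformed_three_nsmul_coneHeightRep_sub_mem_relations K' hKc' hK1' c hc
  have hv : K.value = K'.value := by
    have e1 := soloInformed_value_coneHeightRep K hKc hK1 c hc
    have e2 := soloInformed_value_coneHeightRep K' hKc' hK1' c hc
    have hc' : (c : ℝ) ≠ 0 := Nat.cast_ne_zero.mpr hc
    exact mul_left_cancel₀ hc' (by rw [← e1, ← e2, h])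
  have hE : Equivalent K K' :=
    soloInformed_volumeRung_le_two hHW le_rfl _ _ hKc hKi hKc' hKi' hK1 hK1' hv
  refine soloInformed_equivalent_of_nsmul_sub_mem (N := 3) (by norm_num) ?_
  have e : 3 • (of (soloInformedConeHeightRep K hKc c) - of (soloInformedConeHeightRep K' hKc' c)) =
      (3 • of (soloInformedConeHeightRep K hKc c) - c • of K) + c • (of K - of K') -
      (3 • of (soloInformedConeHeightRep K' hKc' c) - c • of K') := by
    rw [nsmul_sub, nsmul_sub]; abel
  rw [e]
  exact relations.sub_mem (relations.add_mem h3 (relations.nsmul_mem hE c)) h3'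

end Summit.KontsevichZagierPeriods.KontsevichZagierPeriods.Theorems
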